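import Literature.AlgebraicGeometry.Motives.ThickeningLevelsComplex
import Literature.AlgebraicGeometry.Morphisms.DerivationsAtAugmentationDual
import Literature.AlgebraicGeometry.HodgeTheory.AbelianVarietyTangentOfDualNumber
import HarnessLib

/-!
# The tangent vectors of the Artinian levels `𝒪_{B,y₀}/𝔪^{n+2}` at their augmentation have dimension `dim B`

For an abelian variety `B` over `ℂ`, a closed point `y₀` and `n`, with `R = 𝒪_{B,y₀}/𝔪^{n+2}` (`Rt`, `Motives/ThickeningLevelsComplex`)
and its augmentation `ρ = ρℂ B.X y₀ hy₀ (n+1)`: `FiniteDimensional ℂ (DerAt ρ)` and `finrank ℂ (DerAt ρ) = B.dim`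
(`finrank_derAt_ρℂ`) — `DerAt ρ ≃ ((ker ρ)/(ker ρ)²)^∨` (`Morphisms/DerivationsAtAugmentationDual`), `(ker ρ)/(ker ρ)² ≅ 𝔪/𝔪²`
(`ker_ρℂ`, `n + 2 ≥ 2`) and `dim_ℂ 𝔪/𝔪² = dim B` at a closed point (regularity, ★ `finrank_residueField_cotangentSpace_of_isClosed`
of `HodgeTheory/AbelianVarietyTangentOfDualNumber`, with `κ(y₀) = ℂ`, `finrank_complex_cotangentSpace`).  This is the input
`hdim` of the M13 lift model ([MumfordAV1970] §13: the Kodaira–Spencer map of the Poincaré sheaf is injective between spaces of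
EQUAL dimension `g`, hence bijective).  Theorems only.
HC_CM is proved only modulo the 7 printed citations until rung 0 closes.

## References
* [GortzWedhorn2020] U. Görtz, T. Wedhorn, *Algebraic Geometry I* (2nd ed. 2020), (6.4) and Prop. 6.7 (tangent space as `k[ε]`-points, `T_x = (𝔪_x/𝔪_x²)^∨`).
* [GortzWedhorn2023] U. Görtz, T. Wedhorn, *Algebraic Geometry II* (2023), Lemma 24.72 (proof, Step (I)), Prop. 27.20 (p. 611).
* [Mazur1997Deformation] B. Mazur, *An introduction to the deformation theory of Galois representations* (1997), §15.
* [MumfordAV1970] D. Mumford, *Abelian Varieties* (1970), §13 (proof of the Thm. pp. 125–130).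
-/

noncomputable section

universe u v

open TensorProduct CategoryTheory AlgebraicGeometry

namespace Literature.AlgebraicGeometry.Motives.AbelianVariety

open CategoryTheory CategoryTheory.Limits AlgebraicGeometry MonoidalCategory CartesianMonoidalCategory
open Literature.AlgebraicGeometry.Morphisms Literature.AlgebraicGeometry.Morphisms.CechUnitCocycle IsLocalRing

section G9

variable (T' : SchemeOver ℂ) (t : T'.left) [LocallyOfFiniteType T'.hom] (ht : IsClosed ({t} : Set T'.left))

/-- **`ker ρ_n = 𝔪 · (𝒪_{T,t}/𝔪^{n+1})`** for the augmentation `ρℂ` of the `n`-th level. [cite: GortzWedhorn2023, Prop. 27.20 (p. 611)] -/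
theorem ker_ρℂ (n : ℕ) : RingHom.ker (ρℂ T' t ht n) =
    (maximalIdeal (stalkAt T' (topPt T' t))).map
      (Ideal.Quotient.mk (maximalIdeal (stalkAt T' (topPt T' t)) ^ (n + 1))) := by
  ext y
  obtain ⟨r, rfl⟩ := Ideal.Quotient.mk_surjective y
  rw [RingHom.mem_ker, Ideal.mem_map_iff_of_surjective _ Ideal.Quotient.mk_surjective, ρℂ_apply]
  constructor
  · intro h
    have h' : thickρ T' (topPt T' t) n (Ideal.Quotient.mk _ r) = 0 :=
      κhom_injective T' t ht (by rw [h, map_zero])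
    exact ⟨r, (thickρ_eq_zero_iff T' (topPt T' t) n r).1 h', rfl⟩
  · rintro ⟨x, hx, hxr⟩
    rw [Ideal.Quotient.eq] at hxr
    have hr : r ∈ maximalIdeal (stalkAt T' (topPt T' t)) := by
      have : r = x - (x - r) := by ring
      rw [this]
      exact sub_mem hx (pow_le T' (topPt T' t) n hxr)
    rw [(thickρ_eq_zero_iff T' (topPt T' t) n r).2 hr, map_zero]

omit [LocallyOfFiniteType T'.hom] in
/-- `ℂ → κ(t) → 𝔪/𝔪²` is a scalar tower for the canonical `ℂ`-structure of `𝒪_{T,t}`. [cite: GortzWedhorn2023, Prop. 27.20 (p. 611)] -/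
theorem isScalarTower_complex_residueField_cotangentSpace :
    IsScalarTower ℂ (ResidueField (stalkAt T' (topPt T' t))) (CotangentSpace (stalkAt T' (topPt T' t))) := by
  refine ⟨fun c r v => ?_⟩
  obtain ⟨r, rfl⟩ := IsLocalRing.residue_surjective r
  have h2 : ∀ r : stalkAt T' (topPt T' t), (IsLocalRing.residue _ r) • v = r • v :=
    fun r => algebraMap_smul (ResidueField (stalkAt T' (topPt T' t))) r v
  have h1 : c • IsLocalRing.residue _ r = IsLocalRing.residue (stalkAt T' (topPt T' t)) (c • r) := by
    rw [Algebra.smul_def, Algebra.smul_def, map_mul,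
      IsScalarTower.algebraMap_apply ℂ (stalkAt T' (topPt T' t)) (ResidueField (stalkAt T' (topPt T' t)))]
    rfl
  rw [h1, h2, h2, smul_assoc]

include ht in
/-- `κ(t)` is one-dimensional over `ℂ` at a closed point (`κhom` inverts the structure map). [cite: GortzWedhorn2023, Prop. 27.20 (p. 611)] -/
theorem finrank_complex_resField : Module.finrank ℂ (resField T' (topPt T' t)) = 1 := by
  have hbij : Function.Bijective (algebraMap ℂ (resField T' (topPt T' t))) :=
    ⟨fun a b h => by rw [← κhom_algebraMap T' t ht a, ← κhom_algebraMap T' t ht b, h],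
      fun κ' => ⟨κhom T' t ht κ', algebraMap_κhom T' t ht κ'⟩⟩
  let eκ : ℂ ≃ₗ[ℂ] resField T' (topPt T' t) :=
    LinearEquiv.ofBijective (Algebra.linearMap ℂ (resField T' (topPt T' t))) hbij
  rw [← eκ.finrank_eq, Module.finrank_self]

/-- **At a closed point of an abelian variety `dim_ℂ 𝔪/𝔪² = dim B`** (for the canonical `ℂ`-structure of
`𝒪_{B,y₀}`), and `𝔪/𝔪²` is finite-dimensional over `ℂ`. [cite: GortzWedhorn2023, Prop. 27.20 (p. 611)] -/
theorem finrank_complex_cotangentSpace (B : AbelianVariety ℂ) (y₀ : B.X.left)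
    (hy₀ : IsClosed ({y₀} : Set B.X.left)) :
    FiniteDimensional ℂ (CotangentSpace (stalkAt B.X (topPt B.X y₀))) ∧
      Module.finrank ℂ (CotangentSpace (stalkAt B.X (topPt B.X y₀))) = B.dim := by
  haveI : IsRegularLocalRing (stalkAt B.X (topPt B.X y₀)) := B.isRegularLocalRing_stalk y₀
  haveI := isScalarTower_complex_residueField_cotangentSpace B.X y₀
  let κ := ResidueField (stalkAt B.X (topPt B.X y₀))
  have hk1 : Module.finrank ℂ κ = 1 := finrank_complex_resField B.X y₀ hy₀
  haveI : Module.Finite ℂ κ := Module.finite_of_finrank_eq_succ hk1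
  refine ⟨Module.Finite.trans κ _, ?_⟩
  rw [← Module.finrank_mul_finrank ℂ κ (CotangentSpace _), hk1,
    finrank_residueField_cotangentSpace_of_isClosed B hy₀, one_mul]

/-- **γ9 (hdim): the tangent vectors of the level `𝒪_{B,y₀}/𝔪^{n+2}` at its augmentation have dimension `dim B`.**
For an abelian variety `B` over `ℂ`, a closed point `y₀` and `n`:
`FiniteDimensional ℂ (DerAt (ρℂ B.X y₀ hy₀ (n+1))) ∧ finrank ℂ (DerAt (ρℂ B.X y₀ hy₀ (n+1))) = B.dim` — by
`DerAt ρ ≃ (ker ρ/(ker ρ)²)^∨` ((g9-1)), `ker ρ/(ker ρ)² ≅ 𝔪/𝔪²` ((g9-2), `n + 2 ≥ 2`) and `dim_ℂ 𝔪/𝔪² = dim B`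
((g9-3)).  In the M13 tower (B-p20 (g7) γ) take `B := A₀.dualOf Θ hΘ`.
[cite: GortzWedhorn2023, Prop. 27.20 (p. 611)] [cite: GortzWedhorn2020, (6.4) and Prop. 6.7] -/
theorem finrank_derAt_ρℂ (B : AbelianVariety ℂ) (y₀ : B.X.left) (hy₀ : IsClosed ({y₀} : Set B.X.left)) (n : ℕ) :
    FiniteDimensional ℂ (DerAt (ρℂ B.X y₀ hy₀ (n + 1))) ∧
      Module.finrank ℂ (DerAt (ρℂ B.X y₀ hy₀ (n + 1))) = B.dim := by
  obtain ⟨hfin, hdim⟩ := finrank_complex_cotangentSpace B y₀ hy₀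
  haveI := hfin
  obtain ⟨hfin', hdim'⟩ := finrank_cotangent_ker_eq (k := ℂ) (n + 1) (ρℂ B.X y₀ hy₀ (n + 1))
    (ker_ρℂ B.X y₀ hy₀ (n + 1)) (by omega)
  haveI := hfin'
  obtain ⟨hfin'', hdim''⟩ := finrank_derAt_eq (ρℂ B.X y₀ hy₀ (n + 1))
  exact ⟨hfin'', hdim''.trans (hdim'.trans hdim)⟩

end G9

end Literature.AlgebraicGeometry.Motives.AbelianVariety

end
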